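import Summits.SmoothPoincare4.SmoothPoincare4.Theses.CylinderEntropy
import Summits.SmoothPoincare4.SmoothPoincare4.Theorems.CylinderEntropyCylinderRungTwoReduction
import Literature.Geometry.Riemannian.WhiteLocalRegularityCylinderFlow
import Literature.Geometry.Riemannian.SphericalCylinderEntropy
import Literature.Topology.FourManifolds.HomotopyS4CompactProofs
import HarnessLib

/-!
# `CylinderEntropy.SliceIsolation` from the immortality of thin cross-section flows and White's local regularity theorem
# (crux stmt-SmoothPoincare4-7632, closing chain γ: "thin-flow graphicality")

The crux `Summit.SmoothPoincare4.SmoothPoincare4.Theses.CylinderEntropy.SliceIsolation` (route `CylinderEntropy`, rank 3):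
there is a universal `ε > 0` such that every smooth embedding `ι` of a homotopy 4-sphere `M` into `N = S⁴ × ℝ ⊂ ℝ⁶` separating
the two ends with typed cylinder entropy `λ_cyl(range ι) < 1 + ε` has `M ≃ₘ S⁴`.

Chain β of the line `conformal-kernel-domination` closes the crux modulo ONE printed statement of 2025 (Chodosh–Mantoulidis–Schulze,
Cor. 1.5 (b), `n = 4`: mean curvature flow WITH SURGERY in `ℝ⁵`; `helper_sliceIsolationOfCor15b`, p132345).  This file records a
SECOND, surgery-free and flow-with-surgery-free closure, assembled from the LANDED machinery of the sibling crux `CylinderRungTwo`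
(stmt-SmoothPoincare4-7631, line `killing-flux`): `SliceIsolation` follows from

* (γ1) **immortality of thin cross-section flows** (hypothesis `hthin`, spelled out over the landed vocabulary `IsCylinderMCF` of
  `Theorems/CylinderEntropyCylinderRungTwoKillingFluxDefs.lean`): for some `δ > 0`, the mean curvature flow in `N` starting at a
  `δ`-thin separating cross-section embedding `ι` of a compact connected `M` exists as a smooth flow of separating cross-section
  embeddings OF `M` for all `t ≥ 0` — the classical package {short-time existence and uniqueness for the quasilinear strictly
  parabolic flow (the tree proves `Literature.Analysis.PDE.quasilinear_shortTime_existence`), preservation of embeddedness,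
  Hamilton's monotonicity in `N` (PROVED in the tree: `IsCylinderMCF.cylDensity_le`), White's local regularity as an a-priori
  curvature estimate up to the maximal time, the continuation criterion, and isotopy invariance of end-separation}; NO surgery,
  NO genericity, NO 4-manifold topology, and no statement about the diffeomorphism type of `M`;
* (γ2) **White's local regularity theorem** for cylinder flows in single-sheet form, the EXISTING named fact
  `Literature.Geometry.Riemannian.White2005_localRegularity_cylinderFlowSheet` (statement only; Ann. of Math. 161 (2005) Thm. 3.1, §4);

through the landed chain of crux 7631: entropy is non-increasing along the flow (`IsCylinderMCF.cylEntropy_range_le_of_le`, from the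
PROVED Hamilton monotonicity), so the flow stays `(1+ε)`-thin; White's theorem (`helper_whiteSheetOfFact`,
`helper_epsilonRegularityOfWhite`) and the tilt gap (`stub_tiltGap`, consuming the landed flux identity, the area floor and
`measure_ratio_le_cylEntropy`) make the unit normal nowhere horizontal at time `1`, so the shadow `truncL ∘ F 1 : M → S⁴` is an
immersion (`Reduction.injective_mfderiv_truncL_comp`) with one sheet (`stub_oneSheet`), and a graphical cross-section is a standard
sphere (`stub_graphicalIsSphere`).  The universal `ε` of the crux is `min(δ, ε_gap)` with `ε_gap` the constant of the vertical gap.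

WHY A UNIT OF FLOW IS NEEDED (and no static argument can replace it): for every `ε > 0` there are smooth cross-sections isotopic
to a slice with `λ_cyl < 1 + ε` and an exactly vertical tangent plane somewhere (a kink whose tilt turns by `O(√ε)` per dyadic
scale over exponentially many scales), so "thin ⇒ graphical over `S⁴`" is false without the curvature bound that one unit of flow
and White's theorem provide.

The theorem is CONDITIONAL on (γ1) (an unregistered analytic hypothesis, written out) and on the named fact (γ2); nothing is
sorried and no definition is introduced.  Its axiom closure is the closing whitelist (no certificates enter).
-/

noncomputable section

-- the registered namespace `Summit.SmoothPoincare4.SmoothPoincare4.Theorems…` repeats a component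
set_option linter.dupNamespace false

open MeasureTheory Set
open scoped Manifold ContDiff ENNReal Topology BigOperators

namespace Summit.SmoothPoincare4.SmoothPoincare4.Theorems.CylinderEntropySliceIsolation

open Literature.Geometry.Riemannian
open Literature.Geometry.Riemannian.SphericalCylinderEntropy (cylEntropy cylDensity truncL)
open Summit.SmoothPoincare4.SmoothPoincare4.Cruxes.CylinderRungTwo.KillingFlux

/-- **`SliceIsolation` from the immortality of thin cross-section flows and White's local regularity theorem** (registered helper
`helper_sliceIsolationOfThinFlow` of crux stmt-SmoothPoincare4-7632, closing chain γ).  Hypotheses: `hthin` — for some `δ > 0`,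
every `δ`-thin separating smooth cross-section embedding `ι : M → N` of a compact connected `4`-manifold is the time-`0` slice of a
smooth mean curvature flow `IsCylinderMCF M F ν 0` of separating cross-section embeddings of `M` on `[0, ∞)`; and White's theorem
`White2005_localRegularity_cylinderFlowSheet`.  Conclusion: the crux, with `ε = min(δ, ε_gap)`.  Proof: instances from `M ≃ₕ S⁴`;
entropy monotonicity along the flow (Hamilton, PROVED); vertical gap at `t = 1` (White + tilt gap, landed); one sheet and
graphical ⇒ sphere (landed). [cite: White2005, Thm. 3.1 and §4] [cite: Hamilton1993, Thm. 4.1] -/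
theorem helper_sliceIsolationOfThinFlow : (∃ δ : ℝ, 0 < δ ∧ ∀ (M : Type) [TopologicalSpace M] [T2Space M] [SecondCountableTopology M] [ChartedSpace (EuclideanSpace ℝ (Fin 4)) M] [IsManifold (𝓡 4) ∞ M] [CompactSpace M] [ConnectedSpace M] (ι : M → EuclideanSpace ℝ (Fin 6)), Manifold.IsSmoothEmbedding (𝓡 4) (𝓡 6) ∞ ι → (∀ x, ∑ i : Fin 5, ι x (Fin.castSucc i) ^ 2 = 1) → Summit.SmoothPoincare4.SmoothPoincare4.Cruxes.CylinderRungTwo.KillingFlux.SeparatesEnds (Set.range ι) → Literature.Geometry.Riemannian.SphericalCylinderEntropy.cylEntropy (Set.range ι) < ENNReal.ofReal (1 + δ) → ∃ (F : ℝ → M → EuclideanSpace ℝ (Fin 6)) (ν : ℝ → M → EuclideanSpace ℝ (Fin 6)), Summit.SmoothPoincare4.SmoothPoincare4.Cruxes.CylinderRungTwo.KillingFlux.IsCylinderMCF M F ν 0 ∧ F 0 = ι ∧ ∀ t : ℝ, 0 ≤ t → Summit.SmoothPoincare4.SmoothPoincare4.Cruxes.CylinderRungTwo.KillingFlux.SeparatesEnds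 (Set.range (F t))) → Literature.Geometry.Riemannian.White2005_localRegularity_cylinderFlowSheet → Summit.SmoothPoincare4.SmoothPoincare4.Theses.CylinderEntropy.SliceIsolation := by
  rintro ⟨δ, hδ, hthin⟩ hW
  -- VERTICAL GAP (landed chain over the White fact): the universal `ε_gap` of the graphical regime
  obtain ⟨ε, hε, hgap⟩ := stub_tiltGap (helper_epsilonRegularityOfWhite (helper_whiteSheetOfFact hW))
  refine ⟨min δ ε, lt_min hδ hε, ?_⟩
  intro M _ _ _ _ _ e ι hι hN hsep hent
  -- instances from `M ≃ₕ S⁴` (PROVED in the tree)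
  haveI : CompactSpace M :=
    Literature.Topology.FourManifolds.compactSpace_of_homotopyEquiv_sphere_four_holds M e
  haveI : PathConnectedSpace M := by
    haveI := Literature.Topology.FourManifolds.pathConnectedSpace_sphere_four
    exact Literature.Topology.FourManifolds.pathConnectedSpace_of_homotopyEquiv e
  -- the typed entropy hypothesis, read in the two thresholds `δ` and `ε`
  have hent' : cylEntropy (Set.range ι) < ENNReal.ofReal (1 + min δ ε) := hent
  have hentδ : cylEntropy (Set.range ι) < ENNReal.ofReal (1 + δ) :=
    lt_of_lt_of_le hent' (ENNReal.ofReal_le_ofReal (by linarith [min_le_left δ ε]))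
  have hentε : cylEntropy (Set.range ι) < ENNReal.ofReal (1 + ε) :=
    lt_of_lt_of_le hent' (ENNReal.ofReal_le_ofReal (by linarith [min_le_right δ ε]))
  -- (γ1): the immortal smooth flow of separating cross-section embeddings of `M` starting at `ι`
  obtain ⟨F, ν, hflow, hF0, hsepF⟩ := hthin M ι hι hN hsep hentδ
  -- thin along the flow (Hamilton monotonicity, PROVED)
  have hthinF : ∀ s : ℝ, 0 ≤ s → cylEntropy (Set.range (F s)) < ENNReal.ofReal (1 + ε) := fun s hs =>
    lt_of_le_of_lt (hflow.cylEntropy_range_le_of_le le_rfl hs) (by rw [hF0]; exact hentε)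
  -- after one unit of `(1+ε)`-thin flow the normal is nowhere horizontal, so the shadow is an immersion
  have h01 : (0 : ℝ) ≤ 1 := zero_le_one
  have himm : ∀ x : M, Function.Injective (mfderiv (𝓡 4) (𝓡 5)
      ((truncL : EuclideanSpace ℝ (Fin 6) → EuclideanSpace ℝ (Fin 5)) ∘ F 1) x) := by
    intro x
    have hsm : ContMDiff (𝓡 4) (𝓡 6) ∞ (F 1) := (hflow.isSmoothEmbedding _ h01).contMDiff
    refine Reduction.injective_mfderiv_truncL_comp ((hsm x).mdifferentiableAt (by simp))
      ((hflow.isSpacelikeImmersion _ h01).injective_mfderiv x) (hflow.isUnitNormal _ h01).1 ?_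
    exact hgap M F ν 0 hflow 1 (by norm_num)
      (fun s hs => hsepF s (by linarith [hs.1]))
      (fun s hs => hthinF s (by linarith [hs.1])) x
  -- one sheet, and a graphical cross-section is a standard sphere
  have hinj := Summit.SmoothPoincare4.SmoothPoincare4.Theorems.CylinderRungTwo.KillingFlux.stub_oneSheet
    M (F 1) (hflow.isSmoothEmbedding _ h01) (hflow.mem_cyl _ h01) himm
  exact Summit.SmoothPoincare4.SmoothPoincare4.Theorems.CylinderRungTwo.KillingFlux.stub_graphicalIsSphere
    M (F 1) (hflow.isSmoothEmbedding _ h01) (hflow.mem_cyl _ h01) ⟨hinj, himm⟩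

end Summit.SmoothPoincare4.SmoothPoincare4.Theorems.CylinderEntropySliceIsolation

end
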